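/-
Copyright: see repository licence. Literature formalisation — Fitzner–van der Hofstad, App. C.1: the orthogonal
split `‖x‖₂² = ‖w‖₂² + ‖x−w‖₂² + 2wᵀ(x−w)` of a weighted double sum, as an identity in `ℝ≥0∞`.
-/
import Literature.Probability.FitznerVanDerHofstad2017.NobleWeightedBlocks
import HarnessLib

/-!
# The orthogonal split of a weighted double sum (parallelogram identity in `ℝ≥0∞`)

[FvdH17] = Fitzner–van der Hofstad, *Mean-field behavior for nearest-neighbor percolation in `d > 10`*,
EJP 22 (2017) no. 43, arXiv:1506.07977v2 (extended version; its App. C "Additional details for the bounds on the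
NoBLE coefficients" = `AdditionalBoundForLongVersion.tex` of the TeX source is omitted in the journal version).

## What this module proves (all statements kernel-checked; nothing is assumed)

App. C.1 of [FvdH17] (p. 79: the improvement of the bound on the weighted coefficient `Ξ^{(1)}` when one of the
two triangles is trivial; Case a) `u = w ≠ 0`, display (C.2)) splits the weight of a diagram made of two consecutive
displacements `w` and `x − w` "orthogonally":
`‖x‖₂² = ‖w‖₂² + ‖x−w‖₂² + 2 wᵀ(x−w)`, and the cross term drops out of `Σ_{w,x} ‖x‖₂² F(w) G(x−w)` by the
spatial symmetry `F(−w) = F(w)`, leaving `Σ_w ‖w‖₂² F(w) · Σ_y G(y) + Σ_w F(w) · Σ_y ‖y‖₂² G(y)`.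
We record this as an IDENTITY in `ℝ≥0∞`, for arbitrary `F G : ℤ^d → [0,∞]` with `F` even and WITHOUT any
summability hypothesis: the proof pairs `w` with `−w` before expanding (parallelogram law
`‖w+y‖₂² + ‖y−w‖₂² = 2‖w‖₂² + 2‖y‖₂²`), so no signed cross term is ever formed and nothing needs to converge.

* `wt_add_add_wt_sub` — `‖w+y‖₂² + ‖y−w‖₂² = 2(‖w‖₂² + ‖y‖₂²)` in the currency `wt z = ofReal ‖z‖₂²`.
* `tsum_wt_add_mul_of_even` — `Σ_w ‖w+y‖₂² F(w) = Σ_w ‖w‖₂² F(w) + ‖y‖₂² Σ_w F(w)` for even `F`.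
* `tsum_tsum_wt_add_mul_mul_of_even` —
  `Σ_w Σ_y ‖w+y‖₂² F(w) G(y) = (Σ_w ‖w‖₂² F(w)) (Σ_y G(y)) + (Σ_w F(w)) (Σ_y ‖y‖₂² G(y))`.
* `tsum_tsum_wt_mul_mul_sub_of_even` — the same in the convolution shape of (C.2),
  `Σ_w Σ_x ‖x‖₂² F(w) G(x−w) = …` (there `F(w) = ℙ_p(0 ⇔ w)`, `G = 𝓣_{1̲,1,1}(e_ι, ·, 0)`).
* `tsum_tsum_wt_add_mul_mul_of_even_right`, `tsum_tsum_wt_mul_mul_sub_of_even_right` — the same two identities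
  with the evenness hypothesis on the second factor `G` instead of `F`.
* `tsum_tsum_wt_add_mul_mul_le_of_even`, `tsum_tsum_wt_mul_mul_sub_le_of_even` — the `≤` forms.

## Reading notes

(1) Binders: none beyond the evenness of ONE factor (`F (−w) = F w`, resp. `G (−y) = G y`); `d` arbitrary. (2) No percolation letter, no numeral and no table value
occurs: which diagram plays `F` (e.g. `ℙ_p(0 ⇔ w)`) and which plays `G` is App.-C.1-level material for the modules
that consume this identity; the print's `wᵀ(x−w)` lacks the factor `2`, immaterial since the term drops out.
(3) Purely additive: nothing of `NobleWeightedBlocks` is restated or modified.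
-/

namespace Literature.Probability.FitznerVanDerHofstad2017.NobleBlocks

open Literature.Probability.LatticeModels Literature.Probability.Percolation
open Literature.Barriers.CriticalPhenomena (euclidNorm euclidNorm_nonneg)
open scoped BigOperators ENNReal

variable {d : ℕ}

section Parallelogram

/-- The parallelogram law on `ℤ^d` in coordinates. [folklore] -/
private theorem euclidNorm_add_sq_add_euclidNorm_sub_sq' (w y : Site d) :
    euclidNorm (w + y) ^ 2 + euclidNorm (y - w) ^ 2 = 2 * (euclidNorm w ^ 2 + euclidNorm y ^ 2) := by
  have hsq : ∀ z : Site d, euclidNorm z ^ 2 = ∑ i, ((z i : ℤ) : ℝ) ^ 2 := fun z => by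
    rw [euclidNorm, Real.sq_sqrt (Finset.sum_nonneg fun i _ => sq_nonneg _)]
  simp only [hsq, Pi.add_apply, Pi.sub_apply, Int.cast_add, Int.cast_sub, Finset.mul_sum,
    ← Finset.sum_add_distrib]
  exact Finset.sum_congr rfl fun i _ => by ring

/-- **Parallelogram law in the weight currency**: `‖w+y‖₂² + ‖y−w‖₂² = 2(‖w‖₂² + ‖y‖₂²)`.
[cite: FitznerVanDerHofstad2017, App. C.1 Case a) "‖x‖₂² = ‖w‖₂² + ‖x−w‖₂² + wᵀ(x−w) (sic) and spatial symmetry" (arXiv:1506.07977v2 p. 79)] -/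
theorem wt_add_add_wt_sub (w y : Site d) : wt (w + y) + wt (y - w) = 2 * (wt w + wt y) := by
  rw [wt, wt, wt, wt, ← ENNReal.ofReal_add (sq_nonneg _) (sq_nonneg _), euclidNorm_add_sq_add_euclidNorm_sub_sq',
    ENNReal.ofReal_mul zero_le_two, ENNReal.ofReal_ofNat, ENNReal.ofReal_add (sq_nonneg _) (sq_nonneg _)]

/-- **The symmetrised weighted sum**: for even `F`, `Σ_w ‖w+y‖₂² F(w) = Σ_w ‖w‖₂² F(w) + ‖y‖₂² Σ_w F(w)`
in `[0,∞]` (pair `w ↔ −w`, parallelogram law; no cross term, no summability).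
[cite: FitznerVanDerHofstad2017, App. C.1 Case a), display (C.2), first equality (arXiv:1506.07977v2 p. 79)] -/
theorem tsum_wt_add_mul_of_even (F : Site d → ℝ≥0∞) (hF : ∀ w, F (-w) = F w) (y : Site d) :
    ∑' w, wt (w + y) * F w = ∑' w, wt w * F w + wt y * ∑' w, F w := by
  have hS' : ∑' w, wt (w + y) * F w = ∑' w, wt (y - w) * F w := by
    rw [← (Equiv.neg (Site d)).tsum_eq fun w => wt (w + y) * F w]
    refine tsum_congr fun w => ?_
    rw [Equiv.neg_apply, hF, neg_add_eq_sub]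
  have h2 : 2 * ∑' w, wt (w + y) * F w = 2 * (∑' w, wt w * F w + wt y * ∑' w, F w) := by
    calc 2 * ∑' w, wt (w + y) * F w
        = ∑' w, wt (w + y) * F w + ∑' w, wt (y - w) * F w := by rw [two_mul, ← hS']
      _ = ∑' w, (wt (w + y) * F w + wt (y - w) * F w) := ENNReal.tsum_add.symm
      _ = ∑' w, 2 * (wt w * F w + wt y * F w) := by
          refine tsum_congr fun w => ?_
          rw [← add_mul, wt_add_add_wt_sub]; ring
      _ = 2 * (∑' w, wt w * F w + wt y * ∑' w, F w) := by
          rw [ENNReal.tsum_mul_left, ENNReal.tsum_add, ENNReal.tsum_mul_left]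
  exact (ENNReal.mul_right_inj two_ne_zero ENNReal.ofNat_ne_top).mp h2

/-- **The orthogonal split (App. C.1 Case a), (C.2)) as an identity in `[0,∞]`**: for even `F` and any `G`,
`Σ_w Σ_y ‖w+y‖₂² F(w) G(y) = (Σ_w ‖w‖₂² F(w)) (Σ_y G(y)) + (Σ_w F(w)) (Σ_y ‖y‖₂² G(y))`
— no summability needed.
[cite: FitznerVanDerHofstad2017, App. C.1 Case a), display (C.2), first equality (arXiv:1506.07977v2 p. 79); §5.2 Lemma 5.1 (arXiv:1506.07977v2 p. 50)] -/
theorem tsum_tsum_wt_add_mul_mul_of_even (F G : Site d → ℝ≥0∞) (hF : ∀ w, F (-w) = F w) :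
    ∑' w, ∑' y, wt (w + y) * F w * G y =
      (∑' w, wt w * F w) * (∑' y, G y) + (∑' w, F w) * (∑' y, wt y * G y) := by
  rw [ENNReal.tsum_comm]
  calc ∑' y, ∑' w, wt (w + y) * F w * G y
      = ∑' y, (∑' w, wt w * F w + wt y * ∑' w, F w) * G y := by
        refine tsum_congr fun y => ?_
        rw [ENNReal.tsum_mul_right, tsum_wt_add_mul_of_even F hF y]
    _ = ∑' y, ((∑' w, wt w * F w) * G y + (∑' w, F w) * (wt y * G y)) := by
        refine tsum_congr fun y => ?_
        ring
    _ = _ := by rw [ENNReal.tsum_add, ENNReal.tsum_mul_left, ENNReal.tsum_mul_left]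

/-- **The orthogonal split in convolution shape** ((C.2) verbatim: two consecutive displacements `w`, `x − w`):
for even `F`, `Σ_w Σ_x ‖x‖₂² F(w) G(x−w) = (Σ_w ‖w‖₂² F(w)) (Σ_y G(y)) + (Σ_w F(w)) (Σ_y ‖y‖₂² G(y))`.
[cite: FitznerVanDerHofstad2017, App. C.1 Case a), display (C.2), first equality (arXiv:1506.07977v2 p. 79)] -/
theorem tsum_tsum_wt_mul_mul_sub_of_even (F G : Site d → ℝ≥0∞) (hF : ∀ w, F (-w) = F w) :
    ∑' w, ∑' x, wt x * F w * G (x - w) =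
      (∑' w, wt w * F w) * (∑' y, G y) + (∑' w, F w) * (∑' y, wt y * G y) := by
  rw [← tsum_tsum_wt_add_mul_mul_of_even F G hF]
  refine tsum_congr fun w => ?_
  rw [← (Equiv.addRight w).tsum_eq fun x => wt x * F w * G (x - w)]
  refine tsum_congr fun y => ?_
  show wt (y + w) * F w * G (y + w - w) = wt (w + y) * F w * G y
  rw [add_sub_cancel_right, add_comm y w]

/-- **The orthogonal split with the evenness on the second factor**: for any `F` and even `G`,
`Σ_w Σ_y ‖w+y‖₂² F(w) G(y) = (Σ_w ‖w‖₂² F(w)) (Σ_y G(y)) + (Σ_w F(w)) (Σ_y ‖y‖₂² G(y))` (swap the two sums and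
the roles of `F` and `G` in `tsum_tsum_wt_add_mul_mul_of_even`; `‖w+y‖₂² = ‖y+w‖₂²`).
[cite: FitznerVanDerHofstad2017, App. C.1 Case a), display (C.2), first equality, and "the diagram in which u = w = 0, so that the left diagram is trivial, in the same way" (arXiv:1506.07977v2 pp. 79–80)] -/
theorem tsum_tsum_wt_add_mul_mul_of_even_right (F G : Site d → ℝ≥0∞) (hG : ∀ y, G (-y) = G y) :
    ∑' w, ∑' y, wt (w + y) * F w * G y =
      (∑' w, wt w * F w) * (∑' y, G y) + (∑' w, F w) * (∑' y, wt y * G y) := by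
  rw [ENNReal.tsum_comm]
  calc ∑' y, ∑' w, wt (w + y) * F w * G y
      = ∑' y, ∑' w, wt (y + w) * G y * F w :=
        tsum_congr fun y => tsum_congr fun w => by rw [add_comm w y, mul_right_comm]
    _ = (∑' y, wt y * G y) * (∑' w, F w) + (∑' y, G y) * (∑' w, wt w * F w) :=
        tsum_tsum_wt_add_mul_mul_of_even G F hG
    _ = _ := by rw [add_comm, mul_comm (∑' y, G y), mul_comm (∑' y, wt y * G y)]

/-- **The convolution shape with the evenness on the second factor**: for any `F` and even `G`,
`Σ_w Σ_x ‖x‖₂² F(w) G(x−w) = (Σ_w ‖w‖₂² F(w)) (Σ_y G(y)) + (Σ_w F(w)) (Σ_y ‖y‖₂² G(y))`.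
[cite: FitznerVanDerHofstad2017, App. C.1 Case a), display (C.2), first equality (arXiv:1506.07977v2 pp. 79–80)] -/
theorem tsum_tsum_wt_mul_mul_sub_of_even_right (F G : Site d → ℝ≥0∞) (hG : ∀ y, G (-y) = G y) :
    ∑' w, ∑' x, wt x * F w * G (x - w) =
      (∑' w, wt w * F w) * (∑' y, G y) + (∑' w, F w) * (∑' y, wt y * G y) := by
  rw [← tsum_tsum_wt_add_mul_mul_of_even_right F G hG]
  refine tsum_congr fun w => ?_
  rw [← (Equiv.addRight w).tsum_eq fun x => wt x * F w * G (x - w)]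
  refine tsum_congr fun y => ?_
  show wt (y + w) * F w * G (y + w - w) = wt (w + y) * F w * G y
  rw [add_sub_cancel_right, add_comm y w]

/-- The `≤` form of the orthogonal split (the shape in which (C.2) is consumed).
[cite: FitznerVanDerHofstad2017, App. C.1 Case a), display (C.2), first equality (arXiv:1506.07977v2 p. 79)] -/
theorem tsum_tsum_wt_add_mul_mul_le_of_even (F G : Site d → ℝ≥0∞) (hF : ∀ w, F (-w) = F w) :
    ∑' w, ∑' y, wt (w + y) * F w * G y ≤
      (∑' w, wt w * F w) * (∑' y, G y) + (∑' w, F w) * (∑' y, wt y * G y) :=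
  (tsum_tsum_wt_add_mul_mul_of_even F G hF).le

/-- The `≤` form in convolution shape.
[cite: FitznerVanDerHofstad2017, App. C.1 Case a), display (C.2), first equality (arXiv:1506.07977v2 p. 79)] -/
theorem tsum_tsum_wt_mul_mul_sub_le_of_even (F G : Site d → ℝ≥0∞) (hF : ∀ w, F (-w) = F w) :
    ∑' w, ∑' x, wt x * F w * G (x - w) ≤
      (∑' w, wt w * F w) * (∑' y, G y) + (∑' w, F w) * (∑' y, wt y * G y) :=
  (tsum_tsum_wt_mul_mul_sub_of_even F G hF).le

end Parallelogram

end Literature.Probability.FitznerVanDerHofstad2017.NobleBlocks
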